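import Literature.ComputerArithmetic.Shewchuk1997.Compress
import Mathlib.Tactic.Linarith
import Mathlib.Tactic.Positivity
import Mathlib.Tactic.Ring
import Mathlib.Tactic.NormNum

/-!
# COMPRESS: an induction principle for the upward sweep (new work)

New work of the certified-arithmetic venture (ENGINES group: shared numerical engines serving
client cells; rigour lives in the verifiers; every published number belongs to a client cell's
ledger, not to the engines group).  The proof of Theorem 23 of [Shewchuk1997, §2.7] in
`Literature…Shewchuk1997.Compress` runs the upward sweep of COMPRESS (Lines 10–16) as an
induction carrying the state invariant `UpInv p emin c rs Q` (`rs` = the components emitted so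
far, newest first; `Q` = the carry) through the two kinds of FAST-TWO-SUM step — the EXACT
step (`q = 0`: the carry absorbs the component) and the EMITTING step (`q ≠ 0`) — together
with the bookkeeping that re-establishes the carry bound `|Q| ≤ ulp g` for the next component
(`compressUp_spec`).  Every further property of COMPRESS outputs proved in this venture (no
double adjacency and the class W under any tie rule, `CompressWeakExpansion`; the replay
structure of adjacent pairs) is ANOTHER invariant riding on the same sweep, and each such proof
so far re-ran the whole induction.

THIS FILE factors the induction out once and for all.  `UpStable p emin fl c I` says that a
state property `I rs Q` survives both kinds of step under exactly the hypotheses the sweep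
guarantees at a step (`UpInv`, the component `g` a float with `|g| ≥ 2^(emin+p)`, the carry
bound `|Q| ≤ ulp g`).  `compressUp_induction`: from any state satisfying `UpInv` and `I`, the
sweep output is `rs'.reverse ++ [Q']` for a final state `(rs', Q')` again satisfying `UpInv`
and `I`.  `compress_induction`: for a nonempty nonoverlapping expansion `e` of floats and a
stable `I` holding at every empty state, `COMPRESS(e) = rs.reverse ++ [Q]` with `UpInv` and
`I rs Q` — the downward sweep enters only through `compressDown_spec`.  `isChain_output`
turns the usual shape of such invariants (a chain relation along `rs` plus a relation between
the newest component and the carry) into a chain relation along the output.  As a first use,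
`compress_eq_reverse_append` records the output shape with the Theorem-23 invariant for any
admissible roundoff class `c` (in particular `|Σ lower components| < ulp(top component)`).
HONEST FRAMING: no new arithmetic is claimed here; this is the proof architecture of
`compressUp_spec`, abstracted so that later files state only their step lemmas.
-/

namespace Summit.Ventures.CertifiedArithmetic.Expansions

open Literature.ComputerArithmetic.JeannerodRump2018
open Literature.ComputerArithmetic.BoldoJeannerodMelquiondMuller2023 hiding twoSum twoSum_fst
open Literature.ComputerArithmetic.Shewchuk1997

variable {p : ℕ} {emin : ℤ} {fl : ℚ → ℚ}

/-- A state property of the upward sweep (`rs` = emitted components, newest first; `Q` = the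
carry) is STABLE for the roundoff class `c` when it survives the exact step and the emitting
step under the hypotheses the sweep provides at every step.
[cite: Shewchuk1997, Thm 23 p. 333 (proof, Lines 10–16)] -/
structure UpStable (p : ℕ) (emin : ℤ) (fl : ℚ → ℚ) (c : ℚ) (I : List ℚ → ℚ → Prop) :
    Prop where
  /-- the exact step `q = 0`: the carry becomes `x = g + Q`
  [cite: Shewchuk1997, Thm 23 p. 333 (proof, Lines 12–13)] -/
  absorb : ∀ {rs : List ℚ} {Q g : ℚ}, UpInv p emin c rs Q → I rs Q → IsFloat p emin g →
    (2 : ℚ) ^ (emin + p) ≤ |g| → |Q| ≤ ulp p emin g → (fastTwoSum fl g Q).2 = 0 →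
    I rs (fastTwoSum fl g Q).1
  /-- the emitting step `q ≠ 0`: `q` is emitted and the carry becomes `x = fl(g + Q)`
  [cite: Shewchuk1997, Thm 23 p. 333 (proof, Lines 12–16)] -/
  emit : ∀ {rs : List ℚ} {Q g : ℚ}, UpInv p emin c rs Q → I rs Q → IsFloat p emin g →
    (2 : ℚ) ^ (emin + p) ≤ |g| → |Q| ≤ ulp p emin g → (fastTwoSum fl g Q).2 ≠ 0 →
    I ((fastTwoSum fl g Q).2 :: rs) (fastTwoSum fl g Q).1

/-- The conjunction of two stable properties is stable.
[cite: Shewchuk1997, Thm 23 p. 333 (proof, Lines 10–16)] -/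
theorem UpStable.and {c : ℚ} {I J : List ℚ → ℚ → Prop} (hI : UpStable p emin fl c I)
    (hJ : UpStable p emin fl c J) : UpStable p emin fl c (fun rs Q => I rs Q ∧ J rs Q) where
  absorb inv h hg hgbig hQg hq :=
    ⟨hI.absorb inv h.1 hg hgbig hQg hq, hJ.absorb inv h.2 hg hgbig hQg hq⟩
  emit inv h hg hgbig hQg hq :=
    ⟨hI.emit inv h.1 hg hgbig hQg hq, hJ.emit inv h.2 hg hgbig hQg hq⟩

/-- The trivial property is stable. [cite: Shewchuk1997, Thm 23 p. 333 (proof, Lines 10–16)] -/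
theorem upStable_true (c : ℚ) : UpStable p emin fl c (fun _ _ => True) where
  absorb _ _ _ _ _ _ := trivial
  emit _ _ _ _ _ _ := trivial

/-- THE CARRY BOUND FOR THE NEXT COMPONENT (the bookkeeping step of the proof of Theorem 23):
after the step at `g` the new carry `x = fl(g + Q)` satisfies `|x| ≤ ulp y` for the next
component `y`, because `x` lies on the grid `ulp(g + Q) ≤ ulp y` and `|x + r| < ulp y` for the
newly accounted low-order mass `r` (`|r| < ulp(g + Q)`), by the stair condition.
[cite: Shewchuk1997, Thm 23 p. 333 (proof)] -/
theorem carry_le_ulp_next (hp : 2 ≤ p) (hfl : IsRoundNearest p emin fl) {rs rest : List ℚ}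
    {Q g r : ℚ} (hQ : IsFloat p emin Q) (hg : IsFloat p emin g)
    (hgbig : (2 : ℚ) ^ (emin + p) ≤ |g|) (hQg : |Q| ≤ ulp p emin g)
    (hst : UStair p emin (Q + rs.sum + g) rest)
    (hgU : ∀ y ∈ rest.head?, |g| ≤ ulp p emin y) (hr : |r| < ulp p emin (g + Q))
    (hS : (fastTwoSum fl g Q).1 + r = Q + rs.sum + g) :
    ∀ y ∈ rest.head?, |(fastTwoSum fl g Q).1| ≤ ulp p emin y := by
  have hp1 : 1 ≤ p := by omega
  have hg0 : g ≠ 0 := abs_pos.mp ((zpow_pos two_pos _).trans_le hgbig)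
  have hQleg : |Q| ≤ |g| := hQg.trans (ulp_le_abs_of_isFloat hg hg0)
  obtain ⟨h1, -, -, -⟩ := fastTwoSum_exact hp1 hfl hg hQ hQleg
  intro y hy
  have hgy : |g| ≤ ulp p emin y := hgU y hy
  have hT : |(fastTwoSum fl g Q).1 + r| < ulp p emin y := by rw [hS]; exact hst.head_lt hy
  obtain ⟨u, hu, hU⟩ := exists_ulp_eq_two_zpow (p := p) (emin := emin) y
  obtain ⟨k, -, hK⟩ := exists_ulp_eq_two_zpow (p := p) (emin := emin) (g + Q)
  have hkQn : OnGrid k (fastTwoSum fl g Q).1 := by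
    obtain ⟨K, hK'⟩ := exists_fl_eq_int_mul_ulp hp1 hfl (g + Q)
    exact ⟨K, by rw [h1, hK', hK]⟩
  have hku : k ≤ u := by
    have ht2 : |g + Q| ≤ 2 * (2 : ℚ) ^ u :=
      calc |g + Q| ≤ |g| + |Q| := abs_add_le _ _
        _ ≤ |g| + |g| := by linarith
        _ ≤ 2 * (2 : ℚ) ^ u := by rw [← hU]; linarith
    have := ulp_le_two_zpow_of_abs_le hp hu ht2
    rw [hK] at this
    exact (zpow_le_zpow_iff_right₀ (by norm_num : (1 : ℚ) < 2)).mp this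
  rw [hU]
  exact abs_le_two_zpow_of_onGrid hku hkQn (by rw [← hK]; exact hr) (by rw [← hU]; exact hT)

/-- **INDUCTION PRINCIPLE FOR THE UPWARD SWEEP.**  From a state `(rs, Q)` satisfying the
Theorem-23 invariant `UpInv` and a stable property `I`, over remaining components that are
floats `≥ 2^(emin+p)` obeying the stair and chain conditions with the carry below the ulp of
the next component (exactly the hypotheses of `compressUp_spec`), the sweep ends in a state
`(rs', Q')` satisfying `UpInv` and `I`, and its output is `rs'.reverse ++ [Q']`.
[cite: Shewchuk1997, Thm 23 p. 333 (proof, Lines 10–16)] -/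
theorem compressUp_induction (hp : 2 ≤ p) (hfl : IsRoundNearest p emin fl) {c : ℚ}
    (hc : 1 ≤ c) (hflc : RoundoffBelow c fl) {I : List ℚ → ℚ → Prop}
    (hI : UpStable p emin fl c I) :
    ∀ (gs : List ℚ) (Q : ℚ) (rs : List ℚ), UpInv p emin c rs Q → I rs Q →
      (∀ g ∈ gs, IsFloat p emin g) → (∀ g ∈ gs, (2 : ℚ) ^ (emin + p) ≤ |g|) →
      UStair p emin (Q + rs.sum) gs → gs.IsChain (fun a b => |a| ≤ ulp p emin b) →
      (∀ g ∈ gs.head?, |Q| ≤ ulp p emin g) →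
      ∃ rs' : List ℚ, ∃ Q' : ℚ, rs.reverse ++ compressUp fl Q gs = rs'.reverse ++ [Q'] ∧
        UpInv p emin c rs' Q' ∧ I rs' Q' := by
  have hp1 : 1 ≤ p := by omega
  intro gs
  induction gs with
  | nil =>
    intro Q rs inv hIQ _ _ _ _ _
    exact ⟨rs, Q, by rw [compressUp_nil], inv, hIQ⟩
  | cons g rest ih =>
    intro Q rs inv hIQ hF hbig hst hch hQg
    have hg : IsFloat p emin g := hF g (by simp)
    have hgbig : (2 : ℚ) ^ (emin + p) ≤ |g| := hbig g (by simp)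
    have hQg' : |Q| ≤ ulp p emin g := hQg g (by simp)
    have hF' : ∀ x ∈ rest, IsFloat p emin x := fun x hx => hF x (List.mem_cons_of_mem _ hx)
    have hbig' : ∀ x ∈ rest, (2 : ℚ) ^ (emin + p) ≤ |x| :=
      fun x hx => hbig x (List.mem_cons_of_mem _ hx)
    obtain ⟨-, hst'⟩ := uStair_cons.mp hst
    obtain ⟨hgU, hch'⟩ := List.isChain_cons.mp hch
    have hg0 : g ≠ 0 := abs_pos.mp ((zpow_pos two_pos _).trans_le hgbig)
    have hQleg : |Q| ≤ |g| := hQg'.trans (ulp_le_abs_of_isFloat hg hg0)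
    obtain ⟨-, -, -, h4⟩ := fastTwoSum_exact hp1 hfl hg inv.hQ hQleg
    by_cases hq : (fastTwoSum fl g Q).2 = 0
    · -- exact step
      obtain ⟨inv', hQnval, hge⟩ := inv.absorb hp hfl hg hgbig hQg' hq
      have hS : (fastTwoSum fl g Q).1 + rs.sum = Q + rs.sum + g := by rw [hQnval]; ring
      have hr : |rs.sum| < ulp p emin (g + Q) := by
        rw [← hQnval]; exact inv.sum_lt.trans_le (ulp_mono hge)
      rw [compressUp_cons_of_eq_zero hq]
      exact ih _ rs inv' (hI.absorb inv hIQ hg hgbig hQg' hq) hF' hbig' (by rw [hS]; exact hst')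
        hch' (carry_le_ulp_next hp hfl inv.hQ hg hgbig hQg' hst' hgU hr hS)
    · -- emitting step
      obtain ⟨inv', hbound⟩ := inv.emit hp hfl hc hflc hg hgbig hQg' hq
      have hS : (fastTwoSum fl g Q).1 + ((fastTwoSum fl g Q).2 :: rs).sum = Q + rs.sum + g := by
        rw [List.sum_cons]; linarith [h4]
      rw [compressUp_cons_of_ne_zero hq, show rs.reverse ++ (fastTwoSum fl g Q).2 ::
          compressUp fl (fastTwoSum fl g Q).1 rest = ((fastTwoSum fl g Q).2 :: rs).reverse ++
          compressUp fl (fastTwoSum fl g Q).1 rest by simp]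
      exact ih _ _ inv' (hI.emit inv hIQ hg hgbig hQg' hq) hF' hbig' (by rw [hS]; exact hst')
        hch' (carry_le_ulp_next hp hfl inv.hQ hg hgbig hQg' hst' hgU
          (by rw [List.sum_cons]; exact hbound) hS)

/-- **INDUCTION PRINCIPLE FOR COMPRESS.**  For a nonempty nonoverlapping expansion `e` of floats
and a stable property `I` holding at every empty state, `COMPRESS(e) = rs.reverse ++ [Q]` for a
final state `(rs, Q)` of the upward sweep satisfying the Theorem-23 invariant `UpInv` and `I`;
the downward sweep (Lines 1–9) enters only through `compressDown_spec`.
[cite: Shewchuk1997, Thm 23 p. 333 (proof)] -/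
theorem compress_induction (hp : 2 ≤ p) (hfl : IsRoundNearest p emin fl) {c : ℚ} (hc : 1 ≤ c)
    (hflc : RoundoffBelow c fl) {I : List ℚ → ℚ → Prop} (hI : UpStable p emin fl c I)
    (h0 : ∀ Q : ℚ, I [] Q) {e : List ℚ} (he : ∀ x ∈ e, IsFloat p emin x)
    (hexp : IsExpansion 1 e) (hne : e ≠ []) :
    ∃ rs : List ℚ, ∃ Q : ℚ, compress fl e = rs.reverse ++ [Q] ∧ UpInv p emin c rs Q ∧
      I rs Q := by
  cases hrev : e.reverse with
  | nil => exact absurd (List.reverse_eq_nil_iff.mp hrev) hne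
  | cons em rest =>
    have he' : e = rest.reverse ++ [em] := by simpa using congrArg List.reverse hrev
    have hcomp : compress fl e =
        compressUp fl (compressDown fl em rest).2 (compressDown fl em rest).1.reverse := by
      simp only [compress, hrev]
    rw [hcomp]
    subst he'
    have hem : IsFloat p emin em := he em (by simp)
    have hrestF : ∀ y ∈ rest, IsFloat p emin y := fun y hy => he y (by simp [hy])
    have hexp' : IsExpansion 1 rest.reverse := hexp.sublist (List.sublist_append_left _ _)
    have hbel : ∀ y ∈ rest, Below 1 y em := fun y hy =>
      (List.pairwise_append.mp hexp).2.2 y (List.mem_reverse.mpr hy) em (by simp)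
    have outd := compressDown_spec hp hfl rest em hem hrestF hexp' hbel
    generalize hgs : (compressDown fl em rest).1 = gs at *
    generalize hgb : (compressDown fl em rest).2 = gb at *
    have inv : UpInv p emin c [] gb :=
      ⟨by simp, outd.hgb, List.Pairwise.nil, by simp, by simp, by simpa using ulp_pos _⟩
    have hst : UStair p emin (gb + ([] : List ℚ).sum) gs.reverse := by
      have h := uStair_reverse_of_dStair outd.stair
      rw [List.reverse_append, List.reverse_singleton, List.singleton_append, uStair_cons,
        zero_add] at h
      simpa using h.2
    have hch0 := List.isChain_reverse.mpr outd.chain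
    rw [List.reverse_append, List.reverse_singleton, List.singleton_append,
      List.isChain_cons] at hch0
    have outu := compressUp_induction hp hfl hc hflc hI gs.reverse gb [] inv (h0 gb)
      (fun g hg => outd.floats g (List.mem_reverse.mp hg))
      (fun g hg => outd.big g (List.mem_reverse.mp hg)) hst hch0.2 hch0.1
    rwa [List.reverse_nil, List.nil_append] at outu

/-- FROM STATE TO OUTPUT.  An invariant of the usual shape — a chain relation `R` read along
`rs` from newest to oldest, plus `R` between the newest component and the carry — gives the
chain relation `R` along the output `rs.reverse ++ [Q]` (increasing magnitude).
[cite: Shewchuk1997, Thm 23 p. 333 (proof)] -/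
theorem isChain_output {R : ℚ → ℚ → Prop} {rs : List ℚ} {Q : ℚ}
    (hch : rs.IsChain (flip R)) (hhd : ∀ r ∈ rs.head?, R r Q) :
    (rs.reverse ++ [Q]).IsChain R := by
  rw [show rs.reverse ++ [Q] = (Q :: rs).reverse by simp, List.isChain_reverse]
  exact List.isChain_cons.mpr ⟨fun r hr => hhd r hr, hch⟩

/-- THE OUTPUT SHAPE OF COMPRESS with the Theorem-23 invariant, for any admissible roundoff
class `c` (`c = 1` for every round-to-nearest, `c = 2` for round-to-even, `roundoffBelow_one` /
`roundoffBelow_two`): `COMPRESS(e) = rs.reverse ++ [Q]` where the lower components `rs` are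
nonzero floats, pairwise `c`-below each other and `c`-below the top component `Q`, with
`|Σ rs| < ulp Q` — the top component carries the sum to within one ulp.
[cite: Shewchuk1997, Thm 23 p. 333] -/
theorem compress_eq_reverse_append (hp : 2 ≤ p) (hfl : IsRoundNearest p emin fl) {c : ℚ}
    (hc : 1 ≤ c) (hflc : RoundoffBelow c fl) {e : List ℚ} (he : ∀ x ∈ e, IsFloat p emin x)
    (hexp : IsExpansion 1 e) (hne : e ≠ []) :
    ∃ rs : List ℚ, ∃ Q : ℚ, compress fl e = rs.reverse ++ [Q] ∧ UpInv p emin c rs Q := by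
  obtain ⟨rs, Q, h, inv, -⟩ :=
    compress_induction hp hfl hc hflc (upStable_true c) (fun _ => trivial) he hexp hne
  exact ⟨rs, Q, h, inv⟩

end Summit.Ventures.CertifiedArithmetic.Expansions
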